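import Literature.AlgebraicGeometry.Motives.HodgeStructureFourierTransformPoincareDuality
import HarnessLib

/-!
# Beauville's `SL₂(ℤ)` relations for `(u, w) = (e^θ ∧ ·, ℱ)` on `H•(X) = ⋀W` — `(uℱ)³ = ℱ² = (−1)^g (−1)^*`, `ℱ⁴ = 1`, `uℱu = exp(Λ) = · ⋆ e^θ` —
# the Plancherel formulas `τ(ℱz) = (−1)^g ε(z)`, `ε(x ⋆ y) = (−1)^k τ(x ∧ y)`, and André's `∗` as the symplectic Hodge star

[topic AlgebraicGeometry/Motives]

Layer `Literature/AlgebraicGeometry/Motives`, lane `lit-hodgefound` (Track 2 foundations library; prover seat `lit-hodgefound-p34`,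
generation 37, row g37-#6). THEOREMS ONLY (no definition, no named fact, no instance, no notation; net debt `0`). Sequel of rows g37-#2
(`HodgeStructureWeylOperatorBeauvilleForm`: the braid forms `w = exp(f) exp(−e) exp(f) = exp(−e) exp(f) exp(−e)`, `exp(±L) = e^{±θ} ∧ ·`,
`exp(Λ) x = x ⋆ e^θ`), g37-#3 (`ℱ = w`, `ℱ ∘ ℱ = (−1)^g (−1)^*`, `ℱ⁴ = 1`, Parseval `τ(ℱx ∧ y) = τ(x ∧ ℱy)`), g37-#4 (`ℱ(x ⋆ y) = ℱx ∧ ℱy`)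
and g37-#5 (`ℱ(♯ψ₁ ∧ ⋯ ∧ ♯ψ_p) = (−1)^{p+g} i(ψ₁)⋯i(ψ_p)[pt]`).

## Sources, VERBATIM

A. Beauville, *The action of `SL₂` on abelian varieties*, J. Ramanujan Math. Soc. 25 (2010), arXiv:0805.1541 [Beauville2010SL2] (held text
`paper:arxiv-0805.1541`), §2 (p0003): "Recall that the group `SL₂(ℤ)` is generated by the elements `w = (0 −1 ; 1 0)`, `u = (1 1 ; 0 1)` with the
relations `w² = (uw)³`, `w⁴ = 1`. […] Theorem 3.13 of [M] gives `(Φ_𝒫)² = (⊗L ∘ Φ_𝒫)³ = (−1_A)^*[−g]`, so that we have indeed an action of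
`S̃L₂(ℤ)` on `D(A)`, with the central element `z = w̃² = (ũw̃)³` acting as `(−1_A)^*[−g]` […] There is a (unique) group homomorphism
`SL₂(ℤ) → Corr(A)^*` mapping `u` to `Δ_* e^θ` and `w` to `d⁻¹ e^℘`"; §3 (proof of the Theorem, p0004): "`v = uwu`", `v = (1 0 ; 1 1)`;
§4 Theorem (p0005): "`(1 a ; 0 1)·z = e^{aθ} z`, `(1 0 ; a 1)·z = d⁻¹ a^g e^{θ/a} ⋆ z`, `(0 −1 ; 1 0)·z = ℱ(z)`".
H. Lange, *Abelian Varieties over the Complex Numbers* (2023) [Lange2023AbelianVarietiesComplex], §2.5.3 Prop. 2.5.13 (p0133: "the Pontryagin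
product `⋆` and the map `μ^*` are dual to each other"), §6.2.4 Prop. 6.2.20 (p0310: `F|_{Hᵖ} = (−1)^{g + p(p+1)/2} α_p`).
Y. André, *Pour une théorie inconditionnelle des motifs*, Publ. Math. IHÉS 83 (1996) [Andre1996Motifs] (cite-only), §1.2 (p. 11): the
involution `∗` attached to the Lefschetz `𝔰𝔩₂` ("l'élément `(0 1 ; −1 0)` de `SL₂` s'envoie sur `± ∗`").
D. Huybrechts, *Complex Geometry* (2005) [Huybrechts2005] (held), Prop. 1.2.30 and its proof (the `sl(2)`-representation on `⋀•`).

WHAT IS PROVED, AND HOW. §1 (abstract Lefschetz module `(M, h, e)`, `f = L.dual`, `w = L.weylOperator = exp(f) exp(−e) exp(f)`, dot-notation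
extensions of `Literature.Algebra.Lie.HasLefschetzProperty` as in row g37-#2): with `u = exp(e)`, `u⁻¹ = exp(−e)` (`exp(e) exp(−e) = 1`,
Mathlib) and the second braid word `w = exp(−e) exp(f) exp(−e)` (row g37-#2), **`uw = exp(f) exp(−e)`**, **`(uw)³ = (exp(f)exp(−e)exp(f)) ·
(exp(−e)exp(f)exp(−e)) = w²`** (`exp_mul_weylOperator_pow_three`; also `(wu)³ = w²`) and **`uwu = exp(f) = v`** (`exp_mul_weylOperator_mul_exp`)
— Beauville's presentation relations, so that `u ↦ exp(e)`, `w ↦ w` IS a representation of `SL₂(ℤ)` (with `w⁴ = 1`, tree). §2 (on `H•(X) = ⋀W`,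
`u = e^θ ∧ ·`, `w = ℱ`): **`(e^θ∧ ∘ ℱ)³ = ℱ² = (−1)^g (−1)^*`** (Beauville's `z = w² = (uw)³ ↦ (−1_A)^*[−g]`) and **`e^θ ∧ ℱ(e^θ ∧ x) =
x ⋆ e^θ`** (`uwu = v = exp(Λ) = · ⋆ e^θ`: Beauville's "`(e^{δ^*θ})_* z = e^θ ⋆ z`" in the form `v = uwu`). §3 PLANCHEREL: **`τ(ℱz) = (−1)^g ε(z)`**
(`ℱ(1) = (−1)^g [pt]` and Parseval), **`τ(ℱx ∧ ℱy) = (−1)^{g+k} τ(x ∧ y)`** (`y ∈ Hᵏ`) and, through `ℱ(x ⋆ y) = ℱx ∧ ℱy` (row g37-#4),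
**`ε(x ⋆ y) = (−1)^k τ(x ∧ y)`**: the augmentation of the Pontryagin product is the signed cup-product pairing (Prop. 2.5.13 in cohomology).
§4 **ANDRÉ'S `∗` IS THE SYMPLECTIC HODGE STAR: `∗_A(♯ψ₁ ∧ ⋯ ∧ ♯ψ_p) = (−1)^{p(p+1)/2} i(ψ₁)⋯i(ψ_p)[pt]`** (`♯ψ = i(ψ)θ`; from `ℱ =
(−1)^{g + C(p,2)} ∗_A` on `Hᵖ`, row g37-#3, and `ℱ(♯ψ₁ ∧ ⋯ ∧ ♯ψ_p) = (−1)^{p+g} i(ψ₁)⋯i(ψ_p)[pt]`, row g37-#5): Prop. 6.2.20's `α_p` up to sign.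

TWIN NOTICE (RULING 29 bis): nothing of the torus-forms carriers is imported or restated.

## References

* [Beauville2010SL2] A. Beauville, *The action of SL₂ on abelian varieties*, J. Ramanujan Math. Soc. 25 (2010) 253–263, arXiv:0805.1541, §2, §3, §4.
* [Lange2023AbelianVarietiesComplex] H. Lange, *Abelian Varieties over the Complex Numbers*, Springer (2023), §2.5.3 Prop. 2.5.13 (p0133),
  §6.2.4 Prop. 6.2.20 (p0310).
* [Andre1996Motifs] Y. André, *Pour une théorie inconditionnelle des motifs*, Publ. Math. IHÉS 83 (1996), §1.2 (p. 11).
* [Huybrechts2005] D. Huybrechts, *Complex Geometry*, Springer (2005), Prop. 1.2.30.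
-/

noncomputable section

open scoped TensorProduct Nat

namespace Literature.AlgebraicGeometry.Motives

/-! ## §1 The `SL₂(ℤ)` relations `(uw)³ = w²`, `uwu = v` on a Lefschetz module -/

section LefschetzModule

open Literature.Algebra.Lie

variable {K : Type*} [Field K] [CharZero K] {M : Type*} [AddCommGroup M] [Module K M] [FiniteDimensional K M]
  {h e : Module.End K M}

/-- **`u w = exp(f) exp(−e)`** (`u = exp(e)`, `w = exp(−e) exp(f) exp(−e)`, `exp(e) exp(−e) = 1`). [cite: Beauville2010SL2, §2 and §3 (proof of the Theorem)] -/
theorem _root_.Literature.Algebra.Lie.HasLefschetzProperty.exp_mul_weylOperator (L : HasLefschetzProperty h e) (hgr : IsZGrading h) :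
    letI := Algebra.compHom (Module.End K M) (algebraMap ℚ K)
    IsNilpotent.exp e * L.weylOperator hgr = IsNilpotent.exp (L.dual hgr) * IsNilpotent.exp (-e) := by
  letI := Algebra.compHom (Module.End K M) (algebraMap ℚ K)
  rw [L.weylOperator_eq_exp_neg_mul_exp_dual_mul_exp_neg hgr, ← mul_assoc, ← mul_assoc,
    IsNilpotent.exp_mul_exp_neg_self (L.isNilpotent_of_hasLefschetzProperty hgr), one_mul]

/-- **`w u = exp(−e) exp(f)`**. [cite: Beauville2010SL2, §2 and §3 (proof of the Theorem)] -/
theorem _root_.Literature.Algebra.Lie.HasLefschetzProperty.weylOperator_mul_exp (L : HasLefschetzProperty h e) (hgr : IsZGrading h) :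
    letI := Algebra.compHom (Module.End K M) (algebraMap ℚ K)
    L.weylOperator hgr * IsNilpotent.exp e = IsNilpotent.exp (-e) * IsNilpotent.exp (L.dual hgr) := by
  letI := Algebra.compHom (Module.End K M) (algebraMap ℚ K)
  rw [L.weylOperator_eq_exp_neg_mul_exp_dual_mul_exp_neg hgr, mul_assoc, IsNilpotent.exp_neg_mul_exp_self (L.isNilpotent_of_hasLefschetzProperty hgr),
    mul_one]

/-- **BEAUVILLE'S RELATION `(uw)³ = w²`** for `u = exp(e)` and the Weyl operator `w` of a Lefschetz module: `(uw)³ = (exp(f)exp(−e))³ =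
(exp(f)exp(−e)exp(f))(exp(−e)exp(f)exp(−e)) = w · w` by the two braid words for `w` (row g37-#2). With `w⁴ = 1` these are the defining
relations of `SL₂(ℤ) = ⟨u, w ∣ w² = (uw)³, w⁴ = 1⟩`. [cite: Beauville2010SL2, §2 ("w² = (uw)³, w⁴ = 1")] [cite: Huybrechts2005, Prop. 1.2.30] -/
theorem _root_.Literature.Algebra.Lie.HasLefschetzProperty.exp_mul_weylOperator_pow_three (L : HasLefschetzProperty h e) (hgr : IsZGrading h) :
    letI := Algebra.compHom (Module.End K M) (algebraMap ℚ K)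
    (IsNilpotent.exp e * L.weylOperator hgr) ^ 3 = L.weylOperator hgr ^ 2 := by
  letI := Algebra.compHom (Module.End K M) (algebraMap ℚ K)
  have h1 := L.weylOperator_def hgr
  have h2 := L.weylOperator_eq_exp_neg_mul_exp_dual_mul_exp_neg hgr
  rw [L.exp_mul_weylOperator hgr, pow_succ, pow_two, pow_two]
  conv_rhs => lhs; rw [h1]
  conv_rhs => rhs; rw [h2]
  simp only [mul_assoc]

/-- **`(wu)³ = w²`** likewise. [cite: Beauville2010SL2, §2 ("w² = (uw)³, w⁴ = 1")] -/
theorem _root_.Literature.Algebra.Lie.HasLefschetzProperty.weylOperator_mul_exp_pow_three (L : HasLefschetzProperty h e) (hgr : IsZGrading h) :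
    letI := Algebra.compHom (Module.End K M) (algebraMap ℚ K)
    (L.weylOperator hgr * IsNilpotent.exp e) ^ 3 = L.weylOperator hgr ^ 2 := by
  letI := Algebra.compHom (Module.End K M) (algebraMap ℚ K)
  have h1 := L.weylOperator_def hgr
  have h2 := L.weylOperator_eq_exp_neg_mul_exp_dual_mul_exp_neg hgr
  rw [L.weylOperator_mul_exp hgr, pow_succ, pow_two, pow_two]
  conv_rhs => lhs; rw [h2]
  conv_rhs => rhs; rw [h1]
  simp only [mul_assoc]

/-- **BEAUVILLE'S `v = uwu`: `exp(e) w exp(e) = exp(f)`** (`v = (1 0 ; 1 1) = exp(Y)`). [cite: Beauville2010SL2, §3 (proof of the Theorem, "v = uwu")] -/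
theorem _root_.Literature.Algebra.Lie.HasLefschetzProperty.exp_mul_weylOperator_mul_exp (L : HasLefschetzProperty h e) (hgr : IsZGrading h) :
    letI := Algebra.compHom (Module.End K M) (algebraMap ℚ K)
    IsNilpotent.exp e * L.weylOperator hgr * IsNilpotent.exp e = IsNilpotent.exp (L.dual hgr) := by
  letI := Algebra.compHom (Module.End K M) (algebraMap ℚ K)
  rw [L.exp_mul_weylOperator hgr, mul_assoc, IsNilpotent.exp_neg_mul_exp_self (L.isNilpotent_of_hasLefschetzProperty hgr), mul_one]

end LefschetzModule

namespace ExteriorLefschetz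

open ExteriorAlgebra Literature.Algebra.Lie

variable {K : Type*} [Field K] [CharZero K] {W : Type*} [AddCommGroup W] [Module K W] {ω : ExteriorAlgebra K W} {g : ℕ}

/-! ## §2 On `H•(X) = ⋀W`: `(e^θ∧ ∘ ℱ)³ = ℱ² = (−1)^g (−1)^*`, `e^θ ∧ ℱ(e^θ ∧ x) = x ⋆ e^θ` -/

/-- **`(e^θ∧ ∘ w)³ = w²`** on `⋀W` (`u = exp(L) = e^θ ∧ ·`, `e^θ = Σ_{m≤g} θ^m/m!`). [cite: Beauville2010SL2, §2 and §4 Theorem ("(1 a ; 0 1)·z = e^{aθ}z")] -/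
theorem IsSymplectic.mul_exp_mul_weylStar_pow_three (hω : IsSymplectic ω g) :
    (LinearMap.mul K (ExteriorAlgebra K W) (∑ m ∈ Finset.range (g + 1), (m ! : K)⁻¹ • ω ^ m) * weylStar ω g) ^ 3 = weylStar ω g ^ 2 := by
  letI := Algebra.compHom (Module.End K (ExteriorAlgebra K W)) (algebraMap ℚ K)
  haveI := hω.finiteDimensional_exteriorAlgebra
  rw [← hω.exp_mul_eq, hω.weylStar_eq]
  exact hω.hasLefschetzProperty_mul.exp_mul_weylOperator_pow_three _

/-- **BEAUVILLE'S `z = w² = (uw)³ ↦ (−1_A)^*[−g]` ON `H•(X)`: `(e^θ∧ ∘ ℱ)³ = ℱ ∘ ℱ = (−1)^g (−1)^*`** (`g ≥ 1`; `u ↦ e^θ ∧ ·`, `w ↦ ℱ = (e^℘)_*`).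
[cite: Beauville2010SL2, §2 ("(Φ_𝒫)² = (⊗L ∘ Φ_𝒫)³ = (−1_A)^*[−g]") and §4 Theorem] -/
theorem IsSymplectic.mul_exp_mul_fourierTransform_pow_three (hω : IsSymplectic ω g) (hg : 0 < g) :
    (LinearMap.mul K (ExteriorAlgebra K W) (∑ m ∈ Finset.range (g + 1), (m ! : K)⁻¹ • ω ^ m) * fourierTransform ω g) ^ 3 =
      ((-1 : K) ^ g) • (ExteriorAlgebra.map ((-1 : K) • (LinearMap.id : W →ₗ[K] W))).toLinearMap := by
  rw [← hω.fourierTransform_mul_fourierTransform hg, ← pow_two, hω.fourierTransform_eq_weylStar hg]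
  exact hω.mul_exp_mul_weylStar_pow_three

/-- **`(ℱ ∘ e^θ∧)³ = ℱ²`** likewise. [cite: Beauville2010SL2, §2 and §4 Theorem] -/
theorem IsSymplectic.fourierTransform_mul_mul_exp_pow_three (hω : IsSymplectic ω g) (hg : 0 < g) :
    (fourierTransform ω g * LinearMap.mul K (ExteriorAlgebra K W) (∑ m ∈ Finset.range (g + 1), (m ! : K)⁻¹ • ω ^ m)) ^ 3 =
      fourierTransform ω g ^ 2 := by
  letI := Algebra.compHom (Module.End K (ExteriorAlgebra K W)) (algebraMap ℚ K)
  haveI := hω.finiteDimensional_exteriorAlgebra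
  rw [hω.fourierTransform_eq_weylStar hg, ← hω.exp_mul_eq, hω.weylStar_eq]
  exact hω.hasLefschetzProperty_mul.weylOperator_mul_exp_pow_three _

/-- **`e^θ∧ ∘ ℱ ∘ e^θ∧ = exp(Λ) = Σ_{k≤g} Λ^k/k!`** — Beauville's `v = uwu` on `H•(X)`. [cite: Beauville2010SL2, §3 ("v = uwu") and §4 Theorem] -/
theorem IsSymplectic.mul_exp_mul_fourierTransform_mul_mul_exp (hω : IsSymplectic ω g) (hg : 0 < g) :
    LinearMap.mul K (ExteriorAlgebra K W) (∑ m ∈ Finset.range (g + 1), (m ! : K)⁻¹ • ω ^ m) * fourierTransform ω g *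
      LinearMap.mul K (ExteriorAlgebra K W) (∑ m ∈ Finset.range (g + 1), (m ! : K)⁻¹ • ω ^ m) =
        ∑ k ∈ Finset.range (g + 1), (k ! : K)⁻¹ • lefschetzDual ω g ^ k := by
  letI := Algebra.compHom (Module.End K (ExteriorAlgebra K W)) (algebraMap ℚ K)
  haveI := hω.finiteDimensional_exteriorAlgebra
  rw [hω.fourierTransform_eq_weylStar hg, ← hω.exp_mul_eq, hω.weylStar_eq, ← hω.exp_lefschetzDual_eq, ← hω.dual_eq_lefschetzDual hg]
  exact hω.hasLefschetzProperty_mul.exp_mul_weylOperator_mul_exp _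

/-- **`e^θ ∧ ℱ(e^θ ∧ x) = x ⋆ e^θ`** — Beauville's `(1 0 ; 1 1)·z = e^θ ⋆ z` obtained as `v = uwu` from `u ↦ e^θ ∧ ·`, `w ↦ ℱ`.
[cite: Beauville2010SL2, §3 ("v = uwu") and §4 Theorem ("(1 0 ; a 1)·z = d⁻¹aᵍe^{θ/a} ⋆ z")] -/
theorem IsSymplectic.exp_mul_fourierTransform_exp_mul (hω : IsSymplectic ω g) (hg : 0 < g) (x : ExteriorAlgebra K W) :
    (∑ m ∈ Finset.range (g + 1), (m ! : K)⁻¹ • ω ^ m) * fourierTransform ω g ((∑ m ∈ Finset.range (g + 1), (m ! : K)⁻¹ • ω ^ m) * x) =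
      hω.pontryagin x (∑ m ∈ Finset.range (g + 1), (m ! : K)⁻¹ • ω ^ m) := by
  have h := LinearMap.congr_fun (hω.mul_exp_mul_fourierTransform_mul_mul_exp hg) x
  rw [Module.End.mul_apply, Module.End.mul_apply, LinearMap.mul_apply', LinearMap.mul_apply'] at h
  rw [h, LinearMap.sum_apply, hω.pontryagin_sum_inv_factorial_smul_pow]
  exact Finset.sum_congr rfl fun k _ ↦ by rw [LinearMap.smul_apply]

/-! ## §3 Plancherel: `τ(ℱz) = (−1)^g ε(z)`, `τ(ℱx ∧ ℱy) = (−1)^{g+k} τ(x ∧ y)`, `ε(x ⋆ y) = (−1)^k τ(x ∧ y)` -/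

/-- **`τ(ℱz) = (−1)^g ε(z)`**: the trace of the Fourier transform is `(−1)^g` times the augmentation (Parseval `τ(ℱz ∧ 1) = τ(z ∧ ℱ1)` with
`ℱ(1) = (−1)^g[pt]`, `τ(z ∧ [pt]) = ε(z)`). [cite: Lange2023AbelianVarietiesComplex, §6.2.3 Lemma 6.2.14 and Cor. 6.2.16] [cite: Beauville2010SL2, §4 Theorem] -/
theorem IsSymplectic.trace_fourierTransform (hω : IsSymplectic ω g) (hg : 0 < g) (z : ExteriorAlgebra K W) :
    trace ω g (fourierTransform ω g z) = (-1 : K) ^ g * algebraMapInv z := by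
  have hpt := LinearMap.congr_fun hω.trace_comp_mulRight_point_eq_algebraMapInv z
  rw [LinearMap.comp_apply, LinearMap.mulRight_apply, AlgHom.toLinearMap_apply] at hpt
  rw [← mul_one (fourierTransform ω g z), hω.trace_fourierTransform_mul hg, hω.fourierTransform_one hg, mul_smul, mul_smul_comm, map_smul,
    hpt, smul_eq_mul]

/-- **PLANCHEREL `τ(ℱx ∧ ℱy) = (−1)^{g+k} τ(x ∧ y)`** for `y ∈ Hᵏ` (Parseval and `ℱ(ℱy) = (−1)^{g+k} y`).
[cite: Beauville2010SL2, §4 Theorem] [cite: Lange2023AbelianVarietiesComplex, §6.2.3 Thm. 6.2.15] -/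
theorem IsSymplectic.trace_fourierTransform_mul_fourierTransform (hω : IsSymplectic ω g) (hg : 0 < g) (x : ExteriorAlgebra K W) {k : ℕ}
    {y : ExteriorAlgebra K W} (hy : y ∈ ⋀[K]^k W) :
    trace ω g (fourierTransform ω g x * fourierTransform ω g y) = (-1 : K) ^ (g + k) * trace ω g (x * y) := by
  rw [hω.trace_fourierTransform_mul hg, hω.fourierTransform_fourierTransform_apply hg hy, mul_smul_comm, map_smul, smul_eq_mul, add_comm]

/-- **`ε(x ⋆ y) = (−1)^k τ(x ∧ y)`** for `y ∈ Hᵏ`: THE AUGMENTATION OF THE PONTRYAGIN PRODUCT IS THE SIGNED CUP-PRODUCT PAIRING — Lange's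
Prop. 2.5.13 ("`⋆` and `μ^*` are dual") read in cohomology; here from `(−1)^g ε(x ⋆ y) = τ(ℱ(x ⋆ y)) = τ(ℱx ∧ ℱy) = (−1)^{g+k} τ(x ∧ y)`.
[cite: Lange2023AbelianVarietiesComplex, §2.5.3 Prop. 2.5.13] [cite: Lange2023AbelianVarietiesComplex, §6.2.3 Prop. 6.2.18 (a)] -/
theorem IsSymplectic.algebraMapInv_pontryagin (hω : IsSymplectic ω g) (hg : 0 < g) (x : ExteriorAlgebra K W) {k : ℕ}
    {y : ExteriorAlgebra K W} (hy : y ∈ ⋀[K]^k W) :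
    algebraMapInv (hω.pontryagin x y) = (-1 : K) ^ k * trace ω g (x * y) := by
  have hsq : (-1 : K) ^ g * (-1) ^ g = 1 := by rw [← pow_add, ← two_mul, pow_mul, neg_one_sq, one_pow]
  have h := hω.trace_fourierTransform hg (hω.pontryagin x y)
  rw [hω.fourierTransform_pontryagin hg, hω.trace_fourierTransform_mul_fourierTransform hg x hy] at h
  have h2 := congrArg (fun t ↦ (-1 : K) ^ g * t) h
  rw [← mul_assoc, ← mul_assoc, hsq, one_mul, ← pow_add, show g + (g + k) = 2 * g + k by ring, pow_add, pow_mul, neg_one_sq, one_pow,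
    one_mul] at h2
  exact h2.symm

/-! ## §4 André's `∗` is the symplectic Hodge star -/

/-- **`∗_A(♯ψ₁ ∧ ⋯ ∧ ♯ψ_p) = (−1)^{p(p+1)/2} i(ψ₁)⋯i(ψ_p)[pt]`** (`♯ψ = i(ψ)θ ∈ H¹`, `[pt] = θ^g/g!`): André's involution `∗` of the Lefschetz `𝔰𝔩₂`
(`andreStar`, row g31) IS the symplectic Hodge star — contraction of the point class through the symplectic duality — i.e. Lange's `α_p` up
to the sign `(−1)^{p(p+1)/2}`; from `ℱ = (−1)^{g + C(p,2)} ∗_A` on `Hᵖ` (row g37-#3) and `ℱ(♯ψ₁ ∧ ⋯ ∧ ♯ψ_p) = (−1)^{p+g} i(ψ₁)⋯i(ψ_p)[pt]` (row g37-#5).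
[cite: Andre1996Motifs, §1.2 (p. 11)] [cite: Lange2023AbelianVarietiesComplex, §6.2.4 Prop. 6.2.20] -/
theorem IsSymplectic.andreStar_prod_ann_twoVector (hω : IsSymplectic ω g) (hg : 0 < g) {p : ℕ} (ψ : Fin p → Module.Dual K W) :
    andreStar ω g (List.ofFn fun i ↦ ann K W (ψ i) ω).prod =
      (-1 : K) ^ (p + 1).choose 2 • (List.ofFn fun i ↦ ann K W (ψ i)).prod ((g ! : K)⁻¹ • ω ^ g) := by
  have hc : (p + 1).choose 2 = p + p.choose 2 := by
    rw [show 2 = 1 + 1 from rfl, Nat.choose_succ_succ', Nat.choose_one_right]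
  have hsq : (-1 : K) ^ (g + p.choose 2) * (-1) ^ (g + p.choose 2) = 1 := by rw [← pow_add, ← two_mul, pow_mul, neg_one_sq, one_pow]
  have h1 := hω.fourierTransform_apply_eq_smul_andreStar hg (prod_ann_twoVector_mem hω.mem ψ)
  rw [hω.fourierTransform_prod_ann_twoVector hg ψ] at h1
  have h2 := congrArg (fun z ↦ (-1 : K) ^ (g + p.choose 2) • z) h1
  rw [smul_smul, smul_smul, hsq, one_smul, ← pow_add, show g + p.choose 2 + (p + g) = 2 * g + (p + p.choose 2) by ring, pow_add, pow_mul,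
    neg_one_sq, one_pow, one_mul, ← hc] at h2
  exact h2.symm

end ExteriorLefschetz

end Literature.AlgebraicGeometry.Motives
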